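import Mathlib
import Summits.NavierStokesRegularity.NavierStokesRegularity.Theses.ReynoldsMonotone
import HarnessLib

/-!
# `ReynoldsMonotone.PreEulerAssembly` — the route's second assembly (item
  stmt-NavierStokesRegularity-10428, support; pure logic)

**Statement.** `PreEulerRegularity → PostEulerRegularity → ClassicalContinuation → NoBlowupToClay →
NavierStokesRegularity` (the last two inlined).

PROOF (pure logic, by contradiction at a putative singular time `T`): PostEuler gives a BKM-class
Euler solution on `[0,T]` from the datum, PreEuler continues `NS_ν` from it past `T` in the BKM class,
and the continuation glue extends `u` — so NoBlowup holds and NoBlowupToClay concludes.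

HONEST FRAMING: glue between the route's own (open) statements; nothing here bears on the
regularity problem itself.
-/

noncomputable section

set_option linter.dupNamespace false

namespace Summit.NavierStokesRegularity.NavierStokesRegularity.Theorems

/-- **Item stmt-NavierStokesRegularity-10428** (`ReynoldsMonotone.PreEulerAssembly`). [this file] -/
theorem reynoldsMonotone_preEulerAssembly_proof :
    Summit.NavierStokesRegularity.NavierStokesRegularity.Theses.ReynoldsMonotone.PreEulerAssembly := by
  unfold Summit.NavierStokesRegularity.NavierStokesRegularity.Theses.ReynoldsMonotone.PreEulerAssembly
    Summit.NavierStokesRegularity.NavierStokesRegularity.Theses.ReynoldsMonotone.PreEulerRegularity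
    Summit.NavierStokesRegularity.NavierStokesRegularity.Theses.ReynoldsMonotone.PostEulerRegularity
  intro hPre hPost hCont hNBC
  refine hNBC fun ν T hν hT u p hcl hLH hdec => ?_
  by_contra hext
  obtain ⟨U, P, hEuler, hBKM, hU0⟩ := hPost ν T hν hT u p hcl hLH hdec hext
  have hdecU : Literature.Analysis.FluidPDE.HasRapidSpatialDecay (U 0) := by rw [hU0]; exact hdec
  obtain ⟨T', hTT', v, q, hclv, hBv, hLHv, hv0⟩ := hPre T hT U P hEuler hBKM hdecU ν hν
  rw [hU0] at hLHv hv0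
  exact hext (hCont ν T hν hT u p hcl hLH hdec ⟨T', hTT', v, q, hclv, hBv, hLHv, hv0⟩)

end Summit.NavierStokesRegularity.NavierStokesRegularity.Theorems

end
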